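import Mathlib
import Literature.Geometry.Lorentzian.KerrSchildCoord
import Literature.Geometry.Lorentzian.KerrConvergence
import Literature.Geometry.Lorentzian.KerrSchildNullBicharacteristic
import Summits.FinalStateConjecture.FinalStateConjecture.Theorems.ClusterCompletenessRecedingDopplerBudgetAlgebra
import Summits.FinalStateConjecture.FinalStateConjecture.Theorems.ClusterCompletenessRecedingDopplerBudgetField
import Summits.FinalStateConjecture.FinalStateConjecture.Theorems.ClusterCompletenessRecedingDopplerBudgetZones
import Summits.FinalStateConjecture.FinalStateConjecture.Theorems.ClusterCompletenessRecedingDopplerBudgetKinematics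
import Summits.FinalStateConjecture.FinalStateConjecture.Theorems.ClusterCompletenessRecedingDopplerBudgetRayA
import Summits.FinalStateConjecture.FinalStateConjecture.Theorems.ClusterCompletenessRecedingDopplerBudgetRayB

/-!
# Route ClusterCompleteness — `RecedingDopplerBudget`: analysis along one null bicharacteristic, III

Helper file for the support item `stmt-FinalStateConjecture-15025`
(`Summit.FinalStateConjecture.FinalStateConjecture.Theses.ClusterCompleteness.RecedingDopplerBudget`).

Conservation laws and the visit structure of the ray (all parameters in `[0, S]`):

* **flights**: on a parameter interval of exactly flat points the momentum is constant and the
  position is affine (`momentum_eq_of_flat`, `position_eq_of_flat`);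
* **visits**: the Killing energy `E_k = −ξ(u_k)` of hole `k` is constant on every parameter
  interval each of whose points is flat or off the other holes' closed zones
  (`energy_eq_of_offOthers`);
* the flat set and the zone sets `Z_k = {r_k(q_k x(s)) ≤ 16M_k}` are closed, cover `[0, S]`, and the
  zone sets are pairwise disjoint (lab time is `≥ 0` along the ray); at a flat parameter the
  momentum is `η`-null with positive lab energy (`flat_null`, `flat_energy_pos`);
* **entry points** (`exists_entry`): every zone-`k` parameter `σ` is preceded by a flat zone-`k`
  parameter `e ≤ σ` with `[e, σ] ⊆ Z_k`, so `E_k(σ) = E_k(e) > 0` (`energy_pos`).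
-/

noncomputable section

open Literature.Geometry.Lorentzian Set Filter
open scoped Topology InnerProductSpace

namespace Summit.FinalStateConjecture.FinalStateConjecture.Theorems.RecedingDoppler

section Ray

variable {N : ℕ} {M a : Fin N → ℝ} {Λ : Fin N → lorentzGroup} {p : Fin N → E3} {u : Fin N → E4}
  {q : Fin N → E4 → E4} {G : E4 → Fin 4 → Fin 4 → ℝ} {S : ℝ} {x ξ : ℝ → E4}
  (hM : ∀ i, 0 < M i) (ha : ∀ i, |a i| ≤ 1 / 10 * M i)
  (hu : ∀ i, u i = (Λ i : E4 ≃L[ℝ] E4) (E4.basisVector 0))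
  (hv : ∀ i, 0 < u i 0 ∧ ‖E4.spatial (u i)‖ ≤ 1 / 10 * u i 0)
  (hq : ∀ i x, q i x = poincareInv (Λ i) (E4.ofTimeSpace 0 (p i)) x)
  (hsep : ∀ i j, i ≠ j → 1000 * (M i + M j) ≤ dist (p i) (p j) ∧
    0 < ⟪p i - p j, (u i 0)⁻¹ • E4.spatial (u i) - (u j 0)⁻¹ • E4.spatial (u j)⟫_ℝ)
  (hG : ∀ x μ ν, G x μ ν = Minkowski.bilin (E4.basisVector μ) (E4.basisVector ν) -
    ∑ i, Real.smoothTransition (2 - Kerr.radius (a i) (q i x) / (8 * M i)) *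
      (2 * Kerr.scalarH (M i) (a i) (q i x)) *
      ((Λ i : E4 ≃L[ℝ] E4) (Kerr.nullVector (a i) (q i x))) μ *
      ((Λ i : E4 ≃L[ℝ] E4) (Kerr.nullVector (a i) (q i x))) ν)
  (hbi : KerrSchild.IsBicharacteristicOn G x ξ (Icc 0 S))
  (hhor : ∀ s ∈ Icc 0 S, ∀ i, Kerr.rPlus (M i) (a i) < Kerr.radius (a i) (q i (x s)))
  (hnull0 : ∑ μ, ∑ ν, G (x 0) μ ν * ξ 0 μ * ξ 0 ν = 0)
  (hfar0 : ∀ i, 16 * M i ≤ Kerr.radius (a i) (q i (x 0))) (hE0 : 0 < -(ξ 0 0))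
  (ht0 : 0 ≤ x 0 0)

/-! ### Flights: constant momentum, affine position -/

include hM hq hG hbi in
/-- **Momentum is constant along a flight**: if every parameter of `[σ₁, σ₂] ⊆ [0, S]` is exactly
flat, then `ξ(σ₂) = ξ(σ₁)` (`∂G = 0` on the flat region, boundary included). [folklore] -/
theorem momentum_eq_of_flat {σ₁ σ₂ : ℝ} (h1 : 0 ≤ σ₁) (h12 : σ₁ ≤ σ₂) (h2 : σ₂ ≤ S)
    (hflat : ∀ σ ∈ Icc σ₁ σ₂, ∀ i, 16 * M i ≤ Kerr.radius (a i) (q i (x σ))) :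
    ξ σ₂ = ξ σ₁ := by
  have hsub : Icc σ₁ σ₂ ⊆ Icc 0 S := Icc_subset_Icc h1 h2
  ext κ
  exact (hbi.mono hsub).momentum_eq_of_fderiv_eq_zero (convex_Icc σ₁ σ₂) κ
    (fun t ht μ ν ↦ by rw [(hasFDerivAt_field_zero_of_flat hM hq hG (hflat t ht) μ ν).fderiv]; rfl)
    (left_mem_Icc.2 h12) (right_mem_Icc.2 h12)

include hM hq hG hbi in
/-- **Position is affine along a flight**: on a flat parameter interval `[σ₁, σ₂] ⊆ [0, S]`,
`x(σ₂) − x(σ₁) = (σ₂ − σ₁) V` with the constant velocity `V^μ = ∑_ν η^{μν} ξ_ν(σ₁)`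
(straight light ray of Minkowski space; O'Neill 1983, Ch. 3, Ex. 25). [folklore] -/
theorem position_eq_of_flat {σ₁ σ₂ : ℝ} (h1 : 0 ≤ σ₁) (h12 : σ₁ ≤ σ₂) (h2 : σ₂ ≤ S)
    (hflat : ∀ σ ∈ Icc σ₁ σ₂, ∀ i, 16 * M i ≤ Kerr.radius (a i) (q i (x σ))) :
    x σ₂ - x σ₁ = (σ₂ - σ₁) •
      ∑ μ, (∑ ν, Minkowski.bilin (E4.basisVector μ) (E4.basisVector ν) * ξ σ₁ ν) •
        E4.basisVector μ := by
  have hsub : Icc σ₁ σ₂ ⊆ Icc 0 S := Icc_subset_Icc h1 h2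
  set V : E4 := ∑ μ, (∑ ν, Minkowski.bilin (E4.basisVector μ) (E4.basisVector ν) * ξ σ₁ ν) •
    E4.basisVector μ with hV
  -- the velocity along the flight is the constant `V`
  have hvel : ∀ t ∈ Icc σ₁ σ₂, ∀ μ, ∑ ν, G (x t) μ ν * ξ t ν = V μ := by
    intro t ht μ
    have hξ : ξ t = ξ σ₁ :=
      momentum_eq_of_flat hM hq hG hbi h1 ht.1 (ht.2.trans h2)
        (fun σ hσ ↦ hflat σ ⟨hσ.1, hσ.2.trans ht.2⟩)
    rw [hV, KerrSchild.sum_smul_basisVector_apply, hξ]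
    exact Finset.sum_congr rfl fun ν _ ↦ by rw [field_eq_minkowski_of_flat hM hG (hflat t ht)]
  -- each component of `x σ − σ V` has derivative `0` on `[σ₁, σ₂]`
  have hcomp : ∀ μ, x σ₂ μ - σ₂ * V μ = x σ₁ μ - σ₁ * V μ := by
    intro μ
    refine KerrSchild.eq_of_hasDerivAt_zero (f := fun σ ↦ x σ μ - σ * V μ) (convex_Icc σ₁ σ₂)
      (fun t ht ↦ ?_) (left_mem_Icc.2 h12) (right_mem_Icc.2 h12)
    have h3 := (hbi.position t (hsub ht) μ).sub ((hasDerivAt_id t).mul_const (V μ))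
    rw [hvel t ht μ, one_mul, sub_self] at h3
    exact h3
  ext μ
  rw [PiLp.sub_apply, PiLp.smul_apply, smul_eq_mul]
  linarith [hcomp μ]

/-! ### Visits: conservation of the Killing energy off the other zones -/

include hM hu hq hG hbi in
/-- **The Killing energy `E_k = −ξ(u_k)` is constant on a parameter interval each of whose points
is exactly flat or off the closed zones of the holes `j ≠ k`** (`∂G = 0` at flat points;
`∂_{u_k}G = 0` off the other zones; O'Neill 1983, Ch. 9, Lemma 26). [folklore] -/
theorem energy_eq_of_offOthers (k : Fin N) {σ₁ σ₂ : ℝ} (h1 : 0 ≤ σ₁) (h12 : σ₁ ≤ σ₂)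
    (h2 : σ₂ ≤ S)
    (hoff : ∀ σ ∈ Icc σ₁ σ₂, (∀ i, 16 * M i ≤ Kerr.radius (a i) (q i (x σ))) ∨
      ∀ j, j ≠ k → 16 * M j < Kerr.radius (a j) (q j (x σ))) :
    ∑ μ, ξ σ₂ μ * u k μ = ∑ μ, ξ σ₁ μ * u k μ := by
  have hsub : Icc σ₁ σ₂ ⊆ Icc 0 S := Icc_subset_Icc h1 h2
  refine KerrSchild.eq_of_hasDerivAt_zero (f := fun σ ↦ ∑ μ, ξ σ μ * u k μ) (convex_Icc σ₁ σ₂)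
    (fun t ht ↦ ?_) (left_mem_Icc.2 h12) (right_mem_Icc.2 h12)
  have h1 := hbi.hasDerivAt_pairing (hsub ht) (u k)
  have hzero : ∀ μ ν, fderiv ℝ (fun y ↦ G y μ ν) (x t) (u k) = 0 := by
    intro μ ν
    rcases hoff t ht with hf | ho
    · rw [(hasFDerivAt_field_zero_of_flat hM hq hG hf μ ν).fderiv]; rfl
    · exact fderiv_field_apply_u_eq_zero hM hu hq hG k ho μ ν
  simp only [hzero, zero_mul, Finset.sum_const_zero, mul_zero] at h1
  exact h1

/-! ### The flat set and the zone sets -/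

include hq hbi in
/-- The rest-frame radius along the ray, `s ↦ r_k(q_k x(s))`, is continuous on `[0, S]`.
[folklore] -/
theorem continuousOn_radius_ray (k : Fin N) :
    ContinuousOn (fun s ↦ Kerr.radius (a k) (q k (x s))) (Icc 0 S) := by
  have hc := continuous_radius_restFrame (ai := a k) (Λ k) (p k) (hq k)
  exact hc.comp_continuousOn fun s hs ↦ (hbi.continuousAt hs).1.continuousWithinAt

include hq hbi in
/-- The zone set `Z_k = {s ∈ [0, S] | r_k(q_k x(s)) ≤ 16M_k}` is closed. [folklore] -/
theorem isClosed_zone (k : Fin N) :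
    IsClosed {s | s ∈ Icc 0 S ∧ Kerr.radius (a k) (q k (x s)) ≤ 16 * M k} :=
  (continuousOn_radius_ray hq hbi k).preimage_isClosed_of_isClosed isClosed_Icc isClosed_Iic

include hq hbi in
/-- The flat set `F = {s ∈ [0, S] | ∀ i, r_i ≥ 16M_i}` is closed. [folklore] -/
theorem isClosed_flat :
    IsClosed {s | s ∈ Icc 0 S ∧ ∀ i, 16 * M i ≤ Kerr.radius (a i) (q i (x s))} := by
  have : {s | s ∈ Icc 0 S ∧ ∀ i, 16 * M i ≤ Kerr.radius (a i) (q i (x s))} =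
      Icc 0 S ∩ ⋂ i, {s | s ∈ Icc 0 S ∧ 16 * M i ≤ Kerr.radius (a i) (q i (x s))} := by
    ext s
    simp only [mem_setOf_eq, mem_inter_iff, mem_iInter]
    exact ⟨fun h ↦ ⟨h.1, fun i ↦ ⟨h.1, h.2 i⟩⟩, fun h ↦ ⟨h.1, fun i ↦ (h.2 i).2⟩⟩
  rw [this]
  exact isClosed_Icc.inter (isClosed_iInter fun i ↦
    (continuousOn_radius_ray hq hbi i).preimage_isClosed_of_isClosed isClosed_Icc isClosed_Ici)

include hq hbi in
/-- The union of the zone sets of the holes `j ≠ k` (resp. of all holes, `P = ⊤`) is closed.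
[folklore] -/
theorem isClosed_zones (P : Fin N → Prop) :
    IsClosed {s | s ∈ Icc 0 S ∧ ∃ j, P j ∧ Kerr.radius (a j) (q j (x s)) ≤ 16 * M j} := by
  have : {s | s ∈ Icc 0 S ∧ ∃ j, P j ∧ Kerr.radius (a j) (q j (x s)) ≤ 16 * M j} =
      ⋃ j ∈ {j | P j}, {s | s ∈ Icc 0 S ∧ Kerr.radius (a j) (q j (x s)) ≤ 16 * M j} := by
    ext s
    simp only [mem_setOf_eq, mem_iUnion, exists_prop]
    exact ⟨fun ⟨hs, j, hj, hr⟩ ↦ ⟨j, hj, hs, hr⟩, fun ⟨j, hj, hs, hr⟩ ↦ ⟨hs, j, hj, hr⟩⟩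
  rw [this]
  exact (Set.toFinite _).isClosed_biUnion fun j _ ↦ isClosed_zone hq hbi j

omit hM ha hu hv hq hsep hG hbi hhor hnull0 hfar0 hE0 ht0 in
/-- Every parameter is flat or in some zone. [folklore] -/
theorem flat_or_zone (s : ℝ) : (∀ i, 16 * M i ≤ Kerr.radius (a i) (q i (x s))) ∨
    ∃ k, Kerr.radius (a k) (q k (x s)) ≤ 16 * M k := by
  by_cases h : ∀ i, 16 * M i ≤ Kerr.radius (a i) (q i (x s))
  · exact Or.inl h
  · push Not at h
    obtain ⟨k, hk⟩ := h
    exact Or.inr ⟨k, hk.le⟩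

include hM ha hu hv hq hsep hG hbi hhor hnull0 hfar0 hE0 ht0 in
/-- **The zone sets are pairwise disjoint** (lab time is `≥ 0` along the ray). [folklore] -/
theorem zone_eq {s : ℝ} (hs : s ∈ Icc 0 S) {j k : Fin N}
    (hj : Kerr.radius (a j) (q j (x s)) ≤ 16 * M j) (hk : Kerr.radius (a k) (q k (x s)) ≤ 16 * M k) :
    j = k :=
  zone_disjoint hM ha hu hv hq hsep
    (time_mono hM ha hu hv hq hsep hG hbi hhor hnull0 hfar0 hE0 ht0 hs hs le_rfl).2 hj hk

include hM ha hu hv hq hsep hG hbi hhor hnull0 hfar0 hE0 ht0 in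
/-- Off the other zones at a zone-`k` parameter: `r_j > 16M_j` for `j ≠ k`. [folklore] -/
theorem offOthers_of_zone {s : ℝ} (hs : s ∈ Icc 0 S) {k : Fin N}
    (hk : Kerr.radius (a k) (q k (x s)) ≤ 16 * M k) :
    ∀ j, j ≠ k → 16 * M j < Kerr.radius (a j) (q j (x s)) := by
  intro j hjk
  by_contra hle
  exact hjk (zone_eq hM ha hu hv hq hsep hG hbi hhor hnull0 hfar0 hE0 ht0 hs (not_lt.mp hle) hk)

/-! ### Flat parameters: null momentum, positive lab energy -/

include hM hq hG hbi hhor hnull0 in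
/-- At a flat parameter the momentum is `η`-null. [folklore] -/
theorem flat_null {s : ℝ} (hs : s ∈ Icc 0 S)
    (hflat : ∀ i, 16 * M i ≤ Kerr.radius (a i) (q i (x s))) :
    Minkowski.bilin (ξ s) (ξ s) = 0 := by
  have h := null_on hM hq hG hbi hhor hnull0 (hs.1.trans hs.2) s hs
  rwa [field_sum_sum_of_flat hM hG hflat] at h

include hM ha hu hv hq hsep hG hbi hhor hnull0 hfar0 hE0 ht0 in
/-- At a flat parameter the lab energy `−ξ₀` is positive. [folklore] -/
theorem flat_energy_pos {s : ℝ} (hs : s ∈ Icc 0 S)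
    (hflat : ∀ i, 16 * M i ≤ Kerr.radius (a i) (q i (x s))) : 0 < -(ξ s 0) := by
  have h := velocity_zero_pos hM ha hu hv hq hsep hG hbi hhor hnull0 hfar0 hE0 ht0 s hs
  rwa [velocity_zero_of_flat' hM hG hflat] at h

/-! ### Entry points of visits; positivity of the Killing energies -/

include hM ha hu hv hq hsep hG hbi hhor hnull0 hfar0 hE0 ht0 in
/-- **Entry point of a visit.** For a zone-`k` parameter `σ` there is a flat zone-`k` parameter
`e ≤ σ` with `[e, σ] ⊆ Z_k`; the Killing energy of hole `k` is the same at `e` and `σ`.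
(`e` = the last flat parameter before `σ`; the connected set `[e, σ]` is covered by the closed,
pairwise disjoint zone sets and meets `Z_k`.) [folklore] -/
theorem exists_entry {σ : ℝ} (hσ : σ ∈ Icc 0 S) {k : Fin N}
    (hk : Kerr.radius (a k) (q k (x σ)) ≤ 16 * M k) :
    ∃ e ∈ Icc 0 σ, (∀ i, 16 * M i ≤ Kerr.radius (a i) (q i (x e))) ∧
      (∀ σ' ∈ Icc e σ, Kerr.radius (a k) (q k (x σ')) ≤ 16 * M k) ∧
      ∑ μ, ξ σ μ * u k μ = ∑ μ, ξ e μ * u k μ := by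
  -- the last flat parameter `e ≤ σ`
  set Fσ : Set ℝ := {s | s ∈ Icc 0 S ∧ ∀ i, 16 * M i ≤ Kerr.radius (a i) (q i (x s))} ∩ Iic σ
    with hFσ
  have hFc : IsClosed Fσ := (isClosed_flat hq hbi).inter isClosed_Iic
  have h0F : (0 : ℝ) ∈ Fσ := ⟨⟨⟨le_rfl, hσ.1.trans hσ.2⟩, hfar0⟩, hσ.1⟩
  have hFne : Fσ.Nonempty := ⟨0, h0F⟩
  have hFbdd : BddAbove Fσ := ⟨σ, fun s hs ↦ hs.2⟩
  set e := sSup Fσ with he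
  have heF : e ∈ Fσ := hFc.csSup_mem hFne hFbdd
  have heσ : e ≤ σ := heF.2
  have he0 : 0 ≤ e := heF.1.1.1
  -- no flat parameter in `(e, σ]`
  have hnoflat : ∀ s ∈ Ioc e σ, ¬ ∀ i, 16 * M i ≤ Kerr.radius (a i) (q i (x s)) := by
    intro s hs hfl
    have : s ∈ Fσ := ⟨⟨⟨he0.trans hs.1.le, hs.2.trans hσ.2⟩, hfl⟩, hs.2⟩
    have := le_csSup hFbdd this
    linarith [hs.1]
  -- `[e, σ] ⊆ Z_k` by connectedness
  set T : Set ℝ := {s | s ∈ Icc 0 S ∧ Kerr.radius (a k) (q k (x s)) ≤ 16 * M k} with hT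
  set U : Set ℝ := {s | s ∈ Icc 0 S ∧ ∃ j, j ≠ k ∧ Kerr.radius (a j) (q j (x s)) ≤ 16 * M j}
    with hU
  have hTc : IsClosed T := isClosed_zone hq hbi k
  have hUc : IsClosed U := isClosed_zones hq hbi fun j ↦ j ≠ k
  have hTU : ∀ s, s ∈ T → s ∈ U → False := fun s hsT hsU ↦ by
    obtain ⟨j, hjk, hj⟩ := hsU.2
    exact hjk (zone_eq hM ha hu hv hq hsep hG hbi hhor hnull0 hfar0 hE0 ht0 hsT.1 hj hsT.2)
  have hIoc : ∀ s ∈ Ioc e σ, s ∈ T ∪ U := by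
    intro s hs
    have hsS : s ∈ Icc 0 S := ⟨he0.trans hs.1.le, hs.2.trans hσ.2⟩
    rcases flat_or_zone (M := M) (a := a) (q := q) (x := x) s with hf | ⟨j, hj⟩
    · exact absurd hf (hnoflat s hs)
    · by_cases hjk : j = k
      · subst hjk; exact Or.inl ⟨hsS, hj⟩
      · exact Or.inr ⟨hsS, j, hjk, hj⟩
  have hcover : Icc e σ ⊆ T ∪ U := by
    intro s hs
    rcases eq_or_lt_of_le hs.1 with h | h
    · -- `s = e`: either `e = σ ∈ T`, or `e` is a limit of points of the closed set `T ∪ U`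
      subst h
      rcases eq_or_lt_of_le heσ with h' | h'
      · rw [h']; exact Or.inl ⟨hσ, hk⟩
      · have hcl : IsClosed (T ∪ U) := hTc.union hUc
        apply hcl.closure_subset
        rw [Real.mem_closure_iff]
        intro ε hε
        refine ⟨min (e + ε / 2) σ, hIoc _ ⟨lt_min (by linarith) h', min_le_right _ _⟩, ?_⟩
        rw [abs_sub_lt_iff]
        constructor
        · linarith [min_le_left (e + ε / 2) σ]
        · have : e ≤ min (e + ε / 2) σ := le_min (by linarith) heσ
          linarith
    · exact hIoc s ⟨h, hs.2⟩
  have hIccT : Icc e σ ⊆ T := by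
    intro s hs
    rcases hcover hs with hT' | hU'
    · exact hT'
    · exfalso
      -- connectedness: `[e, σ]` meets both `T` (at `σ`) and `U` (at `s`), hence `T ∩ U`
      have hpre := (isPreconnected_closed_iff.mp isPreconnected_Icc) T U hTc hUc hcover
        ⟨σ, ⟨heσ, le_rfl⟩, hσ, hk⟩ ⟨s, hs, hU'⟩
      obtain ⟨s', _, hs'T, hs'U⟩ := hpre
      exact hTU s' hs'T hs'U
  refine ⟨e, ⟨he0, heσ⟩, heF.1.2, fun s hs ↦ (hIccT hs).2, ?_⟩
  refine energy_eq_of_offOthers hM hu hq hG hbi k he0 heσ hσ.2 fun s hs ↦ Or.inr ?_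
  exact offOthers_of_zone hM ha hu hv hq hsep hG hbi hhor hnull0 hfar0 hE0 ht0 (hIccT hs).1
    (hIccT hs).2

include hM ha hu hv hq hsep hG hbi hhor hnull0 hfar0 hE0 ht0 in
/-- **The Killing energy of the visited hole is positive**: `E_k(σ) = −ξ(σ)(u_k) > 0` at every
zone-`k` parameter `σ` (it equals its value at the flat entry point, where it is pinched by the
positive lab energy). [folklore] -/
theorem energy_pos {σ : ℝ} (hσ : σ ∈ Icc 0 S) {k : Fin N}
    (hk : Kerr.radius (a k) (q k (x σ)) ≤ 16 * M k) : 0 < -(∑ μ, ξ σ μ * u k μ) := by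
  obtain ⟨e, he, hfl, _, hE⟩ := exists_entry hM ha hu hv hq hsep hG hbi hhor hnull0 hfar0 hE0 ht0
    hσ hk
  have heS : e ∈ Icc 0 S := ⟨he.1, he.2.trans hσ.2⟩
  have h1 := (energy_pairing_bounds (hv k)
    (flat_null hM hq hG hbi hhor hnull0 heS hfl)
    (flat_energy_pos hM ha hu hv hq hsep hG hbi hhor hnull0 hfar0 hE0 ht0 heS hfl)).1
  rw [hE]
  have := flat_energy_pos hM ha hu hv hq hsep hG hbi hhor hnull0 hfar0 hE0 ht0 heS hfl
  nlinarith [(hv k).1]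

end Ray

end Summit.FinalStateConjecture.FinalStateConjecture.Theorems.RecedingDoppler

end
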